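import Summits.NavierStokesRegularity.FluidComputer.RowChain
import Summits.NavierStokesRegularity.FluidComputer.RowGate
import Summits.NavierStokesRegularity.FluidComputer.RowSegment
import HarnessLib

/-!
# `RowSegmentSound`: the assembly between switches — every member that each row is applied to stays
# in the certified boxes along the four segments of the row chain of record (k53d; gens 19–21: k52)
# (`pub-fluidc-bp3/R1-DESIGN.md` §8.5 / §8.8 (3): the induction `I(n) ⇒ I(n+1)` off the switches)

HONEST FRAMING (cell `pub-fluidc`, blueprint seat bp3, gen 21): low prior, high value-of-information
experiment on Tao's machine paradigm; NOT a claim that NS blows up. No fluid mechanics and no new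
mathematics: `RowChain.all_ok` (the kernel-checked run of the Lean row checker on the 1066 rows of
record and of the 1062 junction checks), `RowGate.gateOK` (the gate data of record is enclosed by
every row's couplings: `k52_all`, decided here — `isK52` tests the constant block `RowRun.k52` shared by the k52 and k53d tables) and `RowSegment.segment_sound_of_chainOK` give, for
the canonical frames and the row starts `T (k+1) = T k + H_k`: along each SEGMENT of consecutive rows
between the switches — rows `0–656`, `657–973`, `974–986`, `987–1065` (`segA` … `segD`; `segment` is
the general statement for any switch-free range) — a member satisfying each row's `MemberOn`
hypotheses on that row, whose frame coordinates start in row `k₀`'s box `u`, stays on every row of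
the segment in that row's boxes `Ē` (errors `e = y − x̂`), `W̄` (frame coordinates), starts in that
row's box `u`, and has phase rate within `ρ` of `1`.  The three switch hand-overs `656|657`,
`973|974`, `986|987` (a new lock coordinate: `Handover.lean`) are NOT in this file.

[cite: Tao2016AveragedNS, §5.5 Thm 5.3 (5.5)]
-/

namespace Summit.NavierStokesRegularity.FluidComputer

open Literature.Analysis.FluidPDE.FluidComputer

namespace RowChain

open RowCheck RowCheck.RowData RowRun Set

/-- The default row (row `0`; used off the range `0 … 1065` only). [folklore] -/
def dflt : RowData := RowRun000k.row0

/-- **Row `k` of the chain of record.** [folklore] -/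
abbrev row (k : ℕ) : RowData := allRows.getD k dflt

/-- Every row (and the default) carries the constant block `RowRun.k52` (P, DEG, KSUB, S, couplings; shared by the k52 and k53d tables). [folklore] -/
theorem k52_all : (dflt :: allRows).all isK52 = true := by
  native_decide

/-- The default row passes the run flags. [folklore] -/
theorem dflt_runOK : dflt.runOK = true := by
  native_decide

/-- [folklore] -/
theorem isK52_row (k : ℕ) : isK52 (row k) = true := by
  have h := List.all_eq_true.mp k52_all
  rw [row, List.getD_eq_getElem?_getD]
  cases e : allRows[k]? with
  | none => exact h dflt (by simp)
  | some r => exact h r (List.mem_cons_of_mem _ (List.mem_of_getElem? e))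

/-- Every row of the chain passes the run flags. [folklore] -/
theorem runOK_row (k : ℕ) : (row k).runOK = true := by
  by_cases hk : k < 1066
  · exact runOK_at dflt k hk
  · rw [row, List.getD_eq_getElem?_getD, List.getElem?_eq_none (by rw [allRows_length]; omega)]
    exact dflt_runOK

/-- [folklore] -/
theorem framesOK_row (k : ℕ) : (row k).framesOK = true := ((runOK_iff _).mp (runOK_row k)).2.2.1

/-- **Gate data of row `k`**: the gate data of record, enclosed by the row's couplings. [folklore] -/
noncomputable def G (k : ℕ) : (row k).GateOK := gateOK (isK52_row k)

/-- **Segment assembly**: along rows `k₀ … k₀+n−1` with no switch position among `k₀ … k₀+n−2`, a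
member satisfying each row's `MemberOn` hypotheses (canonical frames, gate data of record, row starts
`T (k+1) = T k + H`) whose frame coordinates start in row `k₀`'s box `u` stays, on every row `k₀+k`,
in that row's boxes: start box `u`, errors `Ē`, frame coordinates `W̄`, phase rate within `ρ` of `1`.
[folklore] -/
theorem segment (k0 n : ℕ) (hn : k0 + n ≤ 1066) (hsw : ∀ k, k0 ≤ k → k + 1 < k0 + n → k ∉ sw)
    (T : ℕ → ℝ) (hT : ∀ k, T (k + 1) = T k + (row (k0 + k)).Hq) (m : MemberData)
    (hmem : ∀ k < n, (toModel (canon (framesOK_row (k0 + k))) (G (k0 + k)) (T k) m).MemberOn (T (k + 1)))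
    (hu0 : ∀ i, |(toModel (canon (framesOK_row k0)) (G k0) (T 0) m).z (T 0) i| ≤ (row k0).ubR 0 i) :
    ∀ k < n,
      (∀ i, |(toModel (canon (framesOK_row (k0 + k))) (G (k0 + k)) (T k) m).z (T k) i| ≤
        (row (k0 + k)).ubR 0 i) ∧
      (∀ t ∈ Icc (T k) (T (k + 1)), ∀ a,
        |(toModel (canon (framesOK_row (k0 + k))) (G (k0 + k)) (T k) m).e t a| ≤ (row (k0 + k)).EbarR a) ∧
      (∀ t ∈ Icc (T k) (T (k + 1)), ∀ i,
        |(toModel (canon (framesOK_row (k0 + k))) (G (k0 + k)) (T k) m).z t i| ≤ (row (k0 + k)).WbarR i) ∧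
      (∀ t ∈ Ico (T k) (T (k + 1)), |m.sd t - 1| ≤ (row (k0 + k)).rhoR) :=
  segment_sound_of_chainOK dflt all_ok k0 n (by rw [allRows_length]; exact hn) hsw
    (fun k => framesOK_row (k0 + k)) (fun k => G (k0 + k)) T hT m hmem hu0

/-- [folklore] -/
theorem not_sw {a b k : ℕ} (h1 : a ≤ k) (h2 : k + 1 < b)
    (h : (656 < a ∨ b ≤ 657) ∧ (973 < a ∨ b ≤ 974) ∧ (986 < a ∨ b ≤ 987)) : k ∉ sw := by
  simp only [sw, List.mem_cons, List.not_mem_nil, or_false, not_or]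
  omega

/-- **Segment A: rows 0–656** (phase `b1`, `p = 1`). [folklore] -/
theorem segA (T : ℕ → ℝ) (hT : ∀ k, T (k + 1) = T k + (row (0 + k)).Hq) (m : MemberData)
    (hmem : ∀ k < 657,
      (toModel (canon (framesOK_row (0 + k))) (G (0 + k)) (T k) m).MemberOn (T (k + 1)))
    (hu0 : ∀ i, |(toModel (canon (framesOK_row 0)) (G 0) (T 0) m).z (T 0) i| ≤ (row 0).ubR 0 i) :
    ∀ k < 657,
      (∀ i, |(toModel (canon (framesOK_row (0 + k))) (G (0 + k)) (T k) m).z (T k) i| ≤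
        (row (0 + k)).ubR 0 i) ∧
      (∀ t ∈ Icc (T k) (T (k + 1)), ∀ a,
        |(toModel (canon (framesOK_row (0 + k))) (G (0 + k)) (T k) m).e t a| ≤ (row (0 + k)).EbarR a) ∧
      (∀ t ∈ Icc (T k) (T (k + 1)), ∀ i,
        |(toModel (canon (framesOK_row (0 + k))) (G (0 + k)) (T k) m).z t i| ≤ (row (0 + k)).WbarR i) ∧
      (∀ t ∈ Ico (T k) (T (k + 1)), |m.sd t - 1| ≤ (row (0 + k)).rhoR) :=
  segment 0 657 (by norm_num) (fun _ h1 h2 => not_sw h1 h2 (by omega)) T hT m hmem hu0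

/-- **Segment B: rows 657–973** (phase `c1`, `p = 2`). [folklore] -/
theorem segB (T : ℕ → ℝ) (hT : ∀ k, T (k + 1) = T k + (row (657 + k)).Hq) (m : MemberData)
    (hmem : ∀ k < 317,
      (toModel (canon (framesOK_row (657 + k))) (G (657 + k)) (T k) m).MemberOn (T (k + 1)))
    (hu0 : ∀ i, |(toModel (canon (framesOK_row 657)) (G 657) (T 0) m).z (T 0) i| ≤ (row 657).ubR 0 i) :
    ∀ k < 317,
      (∀ i, |(toModel (canon (framesOK_row (657 + k))) (G (657 + k)) (T k) m).z (T k) i| ≤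
        (row (657 + k)).ubR 0 i) ∧
      (∀ t ∈ Icc (T k) (T (k + 1)), ∀ a,
        |(toModel (canon (framesOK_row (657 + k))) (G (657 + k)) (T k) m).e t a| ≤ (row (657 + k)).EbarR a) ∧
      (∀ t ∈ Icc (T k) (T (k + 1)), ∀ i,
        |(toModel (canon (framesOK_row (657 + k))) (G (657 + k)) (T k) m).z t i| ≤ (row (657 + k)).WbarR i) ∧
      (∀ t ∈ Ico (T k) (T (k + 1)), |m.sd t - 1| ≤ (row (657 + k)).rhoR) :=
  segment 657 317 (by norm_num) (fun _ h1 h2 => not_sw h1 h2 (by omega)) T hT m hmem hu0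

/-- **Segment C: rows 974–986** (phase `c1`, `p = 2`, re-selected frame). [folklore] -/
theorem segC (T : ℕ → ℝ) (hT : ∀ k, T (k + 1) = T k + (row (974 + k)).Hq) (m : MemberData)
    (hmem : ∀ k < 13,
      (toModel (canon (framesOK_row (974 + k))) (G (974 + k)) (T k) m).MemberOn (T (k + 1)))
    (hu0 : ∀ i, |(toModel (canon (framesOK_row 974)) (G 974) (T 0) m).z (T 0) i| ≤ (row 974).ubR 0 i) :
    ∀ k < 13,
      (∀ i, |(toModel (canon (framesOK_row (974 + k))) (G (974 + k)) (T k) m).z (T k) i| ≤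
        (row (974 + k)).ubR 0 i) ∧
      (∀ t ∈ Icc (T k) (T (k + 1)), ∀ a,
        |(toModel (canon (framesOK_row (974 + k))) (G (974 + k)) (T k) m).e t a| ≤ (row (974 + k)).EbarR a) ∧
      (∀ t ∈ Icc (T k) (T (k + 1)), ∀ i,
        |(toModel (canon (framesOK_row (974 + k))) (G (974 + k)) (T k) m).z t i| ≤ (row (974 + k)).WbarR i) ∧
      (∀ t ∈ Ico (T k) (T (k + 1)), |m.sd t - 1| ≤ (row (974 + k)).rhoR) :=
  segment 974 13 (by norm_num) (fun _ h1 h2 => not_sw h1 h2 (by omega)) T hT m hmem hu0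

/-- **Segment D: rows 987–1065** (phase `b2`, `p = 5`). [folklore] -/
theorem segD (T : ℕ → ℝ) (hT : ∀ k, T (k + 1) = T k + (row (987 + k)).Hq) (m : MemberData)
    (hmem : ∀ k < 79,
      (toModel (canon (framesOK_row (987 + k))) (G (987 + k)) (T k) m).MemberOn (T (k + 1)))
    (hu0 : ∀ i, |(toModel (canon (framesOK_row 987)) (G 987) (T 0) m).z (T 0) i| ≤ (row 987).ubR 0 i) :
    ∀ k < 79,
      (∀ i, |(toModel (canon (framesOK_row (987 + k))) (G (987 + k)) (T k) m).z (T k) i| ≤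
        (row (987 + k)).ubR 0 i) ∧
      (∀ t ∈ Icc (T k) (T (k + 1)), ∀ a,
        |(toModel (canon (framesOK_row (987 + k))) (G (987 + k)) (T k) m).e t a| ≤ (row (987 + k)).EbarR a) ∧
      (∀ t ∈ Icc (T k) (T (k + 1)), ∀ i,
        |(toModel (canon (framesOK_row (987 + k))) (G (987 + k)) (T k) m).z t i| ≤ (row (987 + k)).WbarR i) ∧
      (∀ t ∈ Ico (T k) (T (k + 1)), |m.sd t - 1| ≤ (row (987 + k)).rhoR) :=
  segment 987 79 (by norm_num) (fun _ h1 h2 => not_sw h1 h2 (by omega)) T hT m hmem hu0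

end RowChain

end Summit.NavierStokesRegularity.FluidComputer
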